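import Literature.Analysis.FluidPDE.KwonDecompositionMomentum
import HarnessLib

/-!
# Kwon's Lemma 2.5: the distributional equation of the drift

Analysis/FluidPDE file on the discharge path of the named fact
`Literature.Analysis.FluidPDE.kwon2023_velocity_epsilon_regularity`
(`PressureFreeEpsilonRegularity.lean`; H. Kwon, J. Differential Equations (2023) =
arXiv:2104.03160, Thm. 1.4), fifteenth brick of Lemma 2.5. Subtracting the perturbed momentum
equation of `v = u − h` (`Kwon2023.momentum_perturbed`, `KwonDecompositionMomentum.lean`) from
the Navier–Stokes momentum equation of `u` on `Q₂ ⊇ O` gives, with `u = v + h` and the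
bilinearity of the transport terms, the **equation of the harmonic part** in the sense of
distributions on `O`:

`∂ₜh + (h·∇)h + ∇(p − q) = Δh − f`, i.e.
`∫∫_O (⟪h, ∂ₜΨ⟫ + ⟪h, (h·∇)Ψ⟫ + ⟪h, ΔΨ⟫ + (p − q) div Ψ − ⟪f, Ψ⟫) = 0` for `Ψ ∈ C_c^∞(O; ℝ³)`

(`drift_momentum_identity`). This is the identity behind the time regularity of `h` and the
relation between the Navier–Stokes pressure `p` and Kwon's pressure `q` used in the transfer of
the local energy inequality from `u` to `v` (Kwon, proof of Lemma 2.5, p. 9: "`v` satisfies the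
local energy inequality"; cf. Remark 2.2: `h` is harmonic and divergence free, so all the
roughness of `h` is in the time variable). No NS-regularity statement is touched.

## Mathlib / tree search

Tree (reused): `momentum_perturbed`, `kwonCyl_two_eq_parabolicCylinderOpens`,
`coe_kwonCyl_two_eq_parabolicCylinder`, `kwonCyl_one_le_two`, `IsGoodVelocity.locallyIntegrable(_sq)`,
`locallyIntegrable_driftField(_sq)`, `locallyIntegrable_sub_driftField(_sq)`
(`KwonDecompositionMomentum`); `integrable_inner_of_locallyIntegrableOn`,
`integrable_mul_of_locallyIntegrableOn`, `IsSpaceTimeTestOn.continuous_divergence_field`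
(`SuitableWeakPressure`); `IsSpaceTimeTestOn.timeDeriv_top/fderiv_top/laplacian_top`,
`timeDeriv_eq_zero_of_notMem`, `fderiv_slice_eq_zero_of_notMem`,
`laplacian_slice_eq_zero_of_notMem_tsupport`.

## References

* H. Kwon, J. Differential Equations (2023) = arXiv:2104.03160: Lemma 2.5, its proof (pp. 8–9),
  Remark 2.2. [Kwon2023RolePressure]
-/

noncomputable section

open MeasureTheory Set Function Filter Topology TopologicalSpace Metric InnerProductSpace
  ContinuousLinearMap
open scoped NNReal ENNReal RealInnerProductSpace Convolution Laplacian ContDiff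

namespace Literature.Analysis.FluidPDE

namespace Kwon2023

variable {W u v h f : ℝ → EuclideanSpace ℝ (Fin 3) → EuclideanSpace ℝ (Fin 3)}
  {p q : ℝ → EuclideanSpace ℝ (Fin 3) → ℝ} {O : Opens (ℝ × EuclideanSpace ℝ (Fin 3))}

/-- `z ↦ ⟪a(z), L(z) b(z)⟫` is integrable on space–time when `|a|², |b|²` are locally integrable
and the continuous operator field `L` is supported in a compact set. [folklore] -/
private theorem integrable_inner_clm_apply_of_sq'
    {a b : ℝ × EuclideanSpace ℝ (Fin 3) → EuclideanSpace ℝ (Fin 3)}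
    (ham : AEStronglyMeasurable a volume) (hbm : AEStronglyMeasurable b volume)
    (ha : LocallyIntegrable (fun z => ‖a z‖ ^ 2) volume)
    (hb : LocallyIntegrable (fun z => ‖b z‖ ^ 2) volume)
    {L : ℝ × EuclideanSpace ℝ (Fin 3) → EuclideanSpace ℝ (Fin 3) →L[ℝ] EuclideanSpace ℝ (Fin 3)}
    (hL : Continuous L) {K : Set (ℝ × EuclideanSpace ℝ (Fin 3))} (hK : IsCompact K)
    (hLK : ∀ z ∉ K, L z = 0) :
    Integrable (fun z => ⟪a z, L z (b z)⟫) (volume : Measure (ℝ × EuclideanSpace ℝ (Fin 3))) := by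
  have haK : IntegrableOn (fun z => ‖a z‖ ^ 2) K volume := ha.integrableOn_isCompact hK
  have hbK : IntegrableOn (fun z => ‖b z‖ ^ 2) K volume := hb.integrableOn_isCompact hK
  have hLc : HasCompactSupport L := HasCompactSupport.intro hK hLK
  obtain ⟨C, hC⟩ := hL.bounded_above_of_compact_support hLc
  have hsupp : support (fun z => ⟪a z, L z (b z)⟫) ⊆ K := by
    intro z hz
    by_contra hzK
    exact hz (by simp [hLK z hzK])
  refine (integrableOn_iff_integrable_of_support_subset hsupp).1 ?_
  refine Integrable.mono' ((haK.add hbK).mul_const C)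
    (ham.inner (isBoundedBilinearMap_apply.continuous.comp_aestronglyMeasurable
      (hL.aestronglyMeasurable.prodMk hbm))).restrict ?_
  filter_upwards with z
  have h0 : 0 ≤ C := (norm_nonneg _).trans (hC z)
  calc ‖⟪a z, L z (b z)⟫‖ ≤ ‖a z‖ * ‖L z (b z)‖ := norm_inner_le_norm _ _
    _ ≤ ‖a z‖ * (C * ‖b z‖) := by
        refine mul_le_mul_of_nonneg_left ((le_opNorm _ _).trans ?_) (norm_nonneg _)
        exact mul_le_mul_of_nonneg_right (hC z) (norm_nonneg _)
    _ = C * (‖a z‖ * ‖b z‖) := by ring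
    _ ≤ C * (‖a z‖ ^ 2 + ‖b z‖ ^ 2) := by
        refine mul_le_mul_of_nonneg_left ?_ h0
        nlinarith [sq_nonneg (‖a z‖ - ‖b z‖), norm_nonneg (a z), norm_nonneg (b z)]
    _ = (‖a z‖ ^ 2 + ‖b z‖ ^ 2) * C := by ring

/-- **The Navier–Stokes identity on the sub-cylinder, for the representative.** For a
distributional solution `(u, p)` on `Q₂(0)`, its good representative `W` and a test field `Ψ` on
`O ⊆ (−4,0) × B₁`: `∫∫_O (⟪W, ∂ₜΨ⟫ + ⟪W, (W·∇)Ψ⟫ + ⟪W, ΔΨ⟫ + p div Ψ) = 0`.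
[cite: Kwon2023RolePressure, Lemma 2.5 (proof, p. 8)] -/
theorem ns_identity_repr (hu : IsDistributionalNSSolutionOn (parabolicCylinderOpens 2
      (0 : ℝ × EuclideanSpace ℝ (Fin 3))) 1 0 u p)
    (hWu : uncurry W =ᵐ[volume] (parabolicCylinder 2 (0 : ℝ × EuclideanSpace ℝ (Fin 3))).indicator (uncurry u))
    (hO : O ≤ kwonCyl (-4) 0 1) {Ψ : ℝ → EuclideanSpace ℝ (Fin 3) → EuclideanSpace ℝ (Fin 3)}
    (hΨ : IsSpaceTimeTestOn O Ψ) :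
    ∫ z in (O : Set (ℝ × EuclideanSpace ℝ (Fin 3))), (⟪W z.1 z.2, timeDeriv Ψ z.1 z.2⟫ +
        ⟪W z.1 z.2, convect (W z.1) (Ψ z.1) z.2⟫ + ⟪W z.1 z.2, Δ (Ψ z.1) z.2⟫ +
        p z.1 z.2 * VectorCalculus.divergence (Ψ z.1) z.2) = 0 := by
  rw [← kwonCyl_two_eq_parabolicCylinderOpens] at hu
  rw [← coe_kwonCyl_two_eq_parabolicCylinder] at hWu
  have hO₂ : O ≤ kwonCyl (-4) 0 2 := hO.trans kwonCyl_one_le_two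
  have hΨ₂ : IsSpaceTimeTestOn (kwonCyl (-4) 0 2) Ψ := hΨ.mono hO₂
  have hQ : MeasurableSet (kwonCyl (-4) 0 2 : Set (ℝ × EuclideanSpace ℝ (Fin 3))) :=
    (kwonCyl (-4) 0 2).isOpen.measurableSet
  have key := hu.2.2.2.2 Ψ hΨ₂
  -- simplify `ν = 1`, `f = 0`
  have e1 : ∀ z : ℝ × EuclideanSpace ℝ (Fin 3),
      ⟪u z.1 z.2, timeDeriv Ψ z.1 z.2⟫ + ⟪u z.1 z.2, convect (u z.1) (Ψ z.1) z.2⟫ +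
        1 * ⟪u z.1 z.2, Δ (Ψ z.1) z.2⟫ + p z.1 z.2 * VectorCalculus.divergence (Ψ z.1) z.2 +
        ⟪(0 : ℝ → EuclideanSpace ℝ (Fin 3) → EuclideanSpace ℝ (Fin 3)) z.1 z.2, Ψ z.1 z.2⟫ =
      ⟪u z.1 z.2, timeDeriv Ψ z.1 z.2⟫ + ⟪u z.1 z.2, convect (u z.1) (Ψ z.1) z.2⟫ +
        ⟪u z.1 z.2, Δ (Ψ z.1) z.2⟫ + p z.1 z.2 * VectorCalculus.divergence (Ψ z.1) z.2 := by
    intro z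
    simp only [one_mul, Pi.zero_apply, inner_zero_left, add_zero]
  have key' : ∫ z in (kwonCyl (-4) 0 2 : Set (ℝ × EuclideanSpace ℝ (Fin 3))),
      (⟪u z.1 z.2, timeDeriv Ψ z.1 z.2⟫ + ⟪u z.1 z.2, convect (u z.1) (Ψ z.1) z.2⟫ +
        ⟪u z.1 z.2, Δ (Ψ z.1) z.2⟫ + p z.1 z.2 * VectorCalculus.divergence (Ψ z.1) z.2) = 0 :=
    (setIntegral_congr_fun hQ fun z _ => (e1 z).symm).trans key
  -- replace `u` by `W` a.e. on `Q₂`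
  have hae : ∀ᵐ z ∂(volume.restrict (kwonCyl (-4) 0 2 : Set (ℝ × EuclideanSpace ℝ (Fin 3)))),
      W z.1 z.2 = u z.1 z.2 := by
    filter_upwards [ae_restrict_mem hQ, ae_restrict_of_ae hWu] with z hz hz'
    rw [indicator_of_mem hz] at hz'
    exact hz'
  have keyW : ∫ z in (kwonCyl (-4) 0 2 : Set (ℝ × EuclideanSpace ℝ (Fin 3))),
      (⟪W z.1 z.2, timeDeriv Ψ z.1 z.2⟫ + ⟪W z.1 z.2, convect (W z.1) (Ψ z.1) z.2⟫ +
        ⟪W z.1 z.2, Δ (Ψ z.1) z.2⟫ + p z.1 z.2 * VectorCalculus.divergence (Ψ z.1) z.2) = 0 := by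
    refine (setIntegral_congr_ae hQ ?_).trans key'
    filter_upwards [(ae_restrict_iff' hQ).1 hae] with z hz hzO
    simp only [convect, hz hzO]
  -- the integrand is supported in `supp Ψ ⊆ O ⊆ Q₂`
  obtain ⟨-, zdiv⟩ := hΨ.continuous_divergence_field
  have hvan : ∀ z : ℝ × EuclideanSpace ℝ (Fin 3), z ∉ tsupport (uncurry Ψ) →
      ⟪W z.1 z.2, timeDeriv Ψ z.1 z.2⟫ + ⟪W z.1 z.2, convect (W z.1) (Ψ z.1) z.2⟫ +
        ⟪W z.1 z.2, Δ (Ψ z.1) z.2⟫ + p z.1 z.2 * VectorCalculus.divergence (Ψ z.1) z.2 = 0 := by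
    intro z hz
    simp only [convect]
    rw [IsSpaceTimeTestOn.timeDeriv_eq_zero_of_notMem hz,
      IsSpaceTimeTestOn.fderiv_slice_eq_zero_of_notMem hz,
      laplacian_slice_eq_zero_of_notMem_tsupport hz, zdiv z hz]
    simp
  rw [setIntegral_eq_integral_of_forall_compl_eq_zero fun z hz =>
    hvan z fun h' => hz (hΨ.tsupport_subset h')]
  rw [setIntegral_eq_integral_of_forall_compl_eq_zero fun z hz =>
    hvan z fun h' => hz (hΨ₂.tsupport_subset h')] at keyW
  exact keyW

/-- **The equation of the harmonic part in the sense of distributions.** With the data of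
`momentum_perturbed` (a distributional Navier–Stokes solution `(u, p)` on `Q₂(0)`, its good
representative `W`, `v = W − h`, `h = H(W)`, Kwon's force `f` and a pressure `q` agreeing slice-a.e.
with Kwon's slice pressure, `q`, `f` locally integrable on `O ⊆ (−4,0) × B₁`), for every
`Ψ ∈ C_c^∞(O; ℝ³)`:
`∫∫_O (⟪h, ∂ₜΨ⟫ + ⟪h, (h·∇)Ψ⟫ + ⟪h, ΔΨ⟫ + (p − q) div Ψ − ⟪f, Ψ⟫) = 0`,
i.e. `∂ₜh + (h·∇)h + ∇(p − q) = Δh − f` in `𝒟'(O)`: the Navier–Stokes identity of `u = v + h`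
minus the perturbed identity of `v`, the transport terms being bilinear.
[cite: Kwon2023RolePressure, Lemma 2.5 (proof, pp. 8–9) with Remark 2.2] -/
theorem drift_momentum_identity (hW : IsGoodVelocity W)
    (hu : IsDistributionalNSSolutionOn (parabolicCylinderOpens 2
      (0 : ℝ × EuclideanSpace ℝ (Fin 3))) 1 0 u p)
    (hWu : uncurry W =ᵐ[volume] (parabolicCylinder 2 (0 : ℝ × EuclideanSpace ℝ (Fin 3))).indicator (uncurry u))
    (hO : O ≤ kwonCyl (-4) 0 1)
    (hv : ∀ t x, v t x = W t x - driftField W t x) (hh : ∀ t x, h t x = driftField W t x)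
    (hf : ∀ t x, f t x = forceField W t x)
    (hq : ∀ᵐ t ∂(volume.restrict (Ioo (-4 : ℝ) 0)), q t =ᵐ[volume] kwonSlicePressure (W t))
    (hqi : LocallyIntegrableOn (uncurry q) (O : Set (ℝ × EuclideanSpace ℝ (Fin 3))) volume)
    (hfi : LocallyIntegrableOn (uncurry f) (O : Set (ℝ × EuclideanSpace ℝ (Fin 3))) volume) :
    ∀ Ψ : ℝ → EuclideanSpace ℝ (Fin 3) → EuclideanSpace ℝ (Fin 3), IsSpaceTimeTestOn O Ψ →
      ∫ z in (O : Set (ℝ × EuclideanSpace ℝ (Fin 3))),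
        (⟪h z.1 z.2, timeDeriv Ψ z.1 z.2⟫ + ⟪h z.1 z.2, convect (h z.1) (Ψ z.1) z.2⟫ +
          ⟪h z.1 z.2, Δ (Ψ z.1) z.2⟫ +
          (p z.1 z.2 - q z.1 z.2) * VectorCalculus.divergence (Ψ z.1) z.2 -
          ⟪f z.1 z.2, Ψ z.1 z.2⟫) = 0 := by
  intro Ψ hΨ
  have hA := ns_identity_repr hu hWu hO hΨ
  have hB := momentum_perturbed hW hu hWu hO hv hh hf hq hqi hfi Ψ hΨ
  have hΨ' : IsSpaceTimeTestOn (⊤ : Opens (ℝ × EuclideanSpace ℝ (Fin 3))) Ψ := hΨ.mono le_top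
  have hpi : LocallyIntegrableOn (uncurry p) (O : Set (ℝ × EuclideanSpace ℝ (Fin 3))) volume := by
    have h1 := hu.2.2.1
    rw [← kwonCyl_two_eq_parabolicCylinderOpens] at h1
    exact h1.mono_set (hO.trans kwonCyl_one_le_two)
  -- ### classes of `W`, `v`, `h`
  have ev : (fun z : ℝ × EuclideanSpace ℝ (Fin 3) => v z.1 z.2) =
      uncurry fun t x => W t x - driftField W t x := by
    funext z; exact hv z.1 z.2
  have eh : (fun z : ℝ × EuclideanSpace ℝ (Fin 3) => h z.1 z.2) = uncurry (driftField W) := by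
    funext z; exact hh z.1 z.2
  have hWm : AEStronglyMeasurable (fun z : ℝ × EuclideanSpace ℝ (Fin 3) => W z.1 z.2) volume :=
    hW.stronglyMeasurable.aestronglyMeasurable
  have hvm : AEStronglyMeasurable (fun z : ℝ × EuclideanSpace ℝ (Fin 3) => v z.1 z.2) volume := by
    rw [ev]
    exact (hW.stronglyMeasurable.sub (stronglyMeasurable_uncurry_driftField hW)).aestronglyMeasurable
  have hhm : AEStronglyMeasurable (fun z : ℝ × EuclideanSpace ℝ (Fin 3) => h z.1 z.2) volume := by
    rw [eh]; exact (stronglyMeasurable_uncurry_driftField hW).aestronglyMeasurable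
  have hWli : LocallyIntegrableOn (uncurry W) (O : Set (ℝ × EuclideanSpace ℝ (Fin 3))) volume :=
    hW.locallyIntegrable.locallyIntegrableOn _
  have hvli : LocallyIntegrableOn (uncurry v) (O : Set (ℝ × EuclideanSpace ℝ (Fin 3))) volume := by
    rw [show uncurry v = fun z => v z.1 z.2 from rfl, ev]
    exact (locallyIntegrable_sub_driftField hW).locallyIntegrableOn _
  have hhli : LocallyIntegrableOn (uncurry h) (O : Set (ℝ × EuclideanSpace ℝ (Fin 3))) volume := by
    rw [show uncurry h = fun z => h z.1 z.2 from rfl, eh]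
    exact (locallyIntegrable_driftField hW).locallyIntegrableOn _
  have hWsq : LocallyIntegrable (fun z : ℝ × EuclideanSpace ℝ (Fin 3) => ‖W z.1 z.2‖ ^ 2) volume :=
    hW.locallyIntegrable_sq
  have hvsq : LocallyIntegrable (fun z : ℝ × EuclideanSpace ℝ (Fin 3) => ‖v z.1 z.2‖ ^ 2) volume := by
    have e : (fun z : ℝ × EuclideanSpace ℝ (Fin 3) => ‖v z.1 z.2‖ ^ 2) =
        fun z => ‖uncurry (fun t x => W t x - driftField W t x) z‖ ^ 2 := by
      funext z; rw [hv]; rfl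
    rw [e]; exact locallyIntegrable_sub_driftField_sq hW
  have hhsq : LocallyIntegrable (fun z : ℝ × EuclideanSpace ℝ (Fin 3) => ‖h z.1 z.2‖ ^ 2) volume := by
    have e : (fun z : ℝ × EuclideanSpace ℝ (Fin 3) => ‖h z.1 z.2‖ ^ 2) =
        fun z => ‖uncurry (driftField W) z‖ ^ 2 := by
      funext z; rw [hh]; rfl
    rw [e]; exact locallyIntegrable_driftField_sq hW
  -- ### test factors
  obtain ⟨K, hK⟩ : ∃ K : Set (ℝ × EuclideanSpace ℝ (Fin 3)), K = tsupport (uncurry Ψ) := ⟨_, rfl⟩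
  have hKc : IsCompact K := hK ▸ hΨ.hasCompactSupport
  have hKO : K ⊆ (O : Set (ℝ × EuclideanSpace ℝ (Fin 3))) := hK ▸ hΨ.tsupport_subset
  have cT : Continuous fun z : ℝ × EuclideanSpace ℝ (Fin 3) => timeDeriv Ψ z.1 z.2 :=
    hΨ'.timeDeriv_top.contDiff.continuous
  have cD : Continuous fun z : ℝ × EuclideanSpace ℝ (Fin 3) => fderiv ℝ (Ψ z.1) z.2 :=
    hΨ'.fderiv_top.contDiff.continuous
  have cL : Continuous fun z : ℝ × EuclideanSpace ℝ (Fin 3) => (Δ (Ψ z.1)) z.2 :=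
    hΨ'.laplacian_top.contDiff.continuous
  obtain ⟨cdiv, zdiv⟩ := hΨ.continuous_divergence_field
  have cΨ : Continuous fun z : ℝ × EuclideanSpace ℝ (Fin 3) => Ψ z.1 z.2 := hΨ.contDiff.continuous
  have zT : ∀ z ∉ K, timeDeriv Ψ z.1 z.2 = 0 := fun z hz =>
    IsSpaceTimeTestOn.timeDeriv_eq_zero_of_notMem (hK ▸ hz)
  have zD : ∀ z ∉ K, fderiv ℝ (Ψ z.1) z.2 = 0 := fun z hz =>
    IsSpaceTimeTestOn.fderiv_slice_eq_zero_of_notMem (hK ▸ hz)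
  have zL : ∀ z ∉ K, (Δ (Ψ z.1)) z.2 = 0 := fun z hz =>
    laplacian_slice_eq_zero_of_notMem_tsupport (hK ▸ hz)
  have zΨ : ∀ z ∉ K, Ψ z.1 z.2 = 0 := fun z hz =>
    (image_eq_zero_of_notMem_tsupport (hK ▸ hz) : uncurry Ψ z = 0)
  have zdivK : ∀ z ∉ K, VectorCalculus.divergence (Ψ z.1) z.2 = 0 := fun z hz => zdiv z (hK ▸ hz)
  -- ### integrability of the two integrands on `O`
  have A1 : Integrable (fun z : ℝ × EuclideanSpace ℝ (Fin 3) => ⟪W z.1 z.2, timeDeriv Ψ z.1 z.2⟫) :=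
    integrable_inner_of_locallyIntegrableOn hWli cT hKc hKO zT
  have A2 : Integrable (fun z : ℝ × EuclideanSpace ℝ (Fin 3) =>
      ⟪W z.1 z.2, convect (W z.1) (Ψ z.1) z.2⟫) :=
    integrable_inner_clm_apply_of_sq' hWm hWm hWsq hWsq cD hKc zD
  have A3 : Integrable (fun z : ℝ × EuclideanSpace ℝ (Fin 3) => ⟪W z.1 z.2, (Δ (Ψ z.1)) z.2⟫) :=
    integrable_inner_of_locallyIntegrableOn hWli cL hKc hKO zL
  have A4 : Integrable (fun z : ℝ × EuclideanSpace ℝ (Fin 3) =>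
      p z.1 z.2 * VectorCalculus.divergence (Ψ z.1) z.2) :=
    integrable_mul_of_locallyIntegrableOn (F := uncurry p) hpi cdiv hKc hKO zdivK
  have IA : Integrable (fun z : ℝ × EuclideanSpace ℝ (Fin 3) =>
      ⟪W z.1 z.2, timeDeriv Ψ z.1 z.2⟫ + ⟪W z.1 z.2, convect (W z.1) (Ψ z.1) z.2⟫ +
        ⟪W z.1 z.2, Δ (Ψ z.1) z.2⟫ + p z.1 z.2 * VectorCalculus.divergence (Ψ z.1) z.2) :=
    ((A1.add A2).add A3).add A4
  have B1 : Integrable (fun z : ℝ × EuclideanSpace ℝ (Fin 3) => ⟪v z.1 z.2, timeDeriv Ψ z.1 z.2⟫) :=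
    integrable_inner_of_locallyIntegrableOn hvli cT hKc hKO zT
  have B2 : Integrable (fun z : ℝ × EuclideanSpace ℝ (Fin 3) =>
      1 * ⟪v z.1 z.2, convect (v z.1) (Ψ z.1) z.2⟫) :=
    (integrable_inner_clm_apply_of_sq' hvm hvm hvsq hvsq cD hKc zD).const_mul 1
  have B3 : Integrable (fun z : ℝ × EuclideanSpace ℝ (Fin 3) =>
      ⟪h z.1 z.2, convect (v z.1) (Ψ z.1) z.2⟫) :=
    integrable_inner_clm_apply_of_sq' hhm hvm hhsq hvsq cD hKc zD
  have B4 : Integrable (fun z : ℝ × EuclideanSpace ℝ (Fin 3) =>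
      ⟪v z.1 z.2, convect (h z.1) (Ψ z.1) z.2⟫) :=
    integrable_inner_clm_apply_of_sq' hvm hhm hvsq hhsq cD hKc zD
  have B5 : Integrable (fun z : ℝ × EuclideanSpace ℝ (Fin 3) => ⟪v z.1 z.2, (Δ (Ψ z.1)) z.2⟫) :=
    integrable_inner_of_locallyIntegrableOn hvli cL hKc hKO zL
  have B6 : Integrable (fun z : ℝ × EuclideanSpace ℝ (Fin 3) =>
      q z.1 z.2 * VectorCalculus.divergence (Ψ z.1) z.2) :=
    integrable_mul_of_locallyIntegrableOn (F := uncurry q) hqi cdiv hKc hKO zdivK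
  have B7 : Integrable (fun z : ℝ × EuclideanSpace ℝ (Fin 3) => ⟪f z.1 z.2, Ψ z.1 z.2⟫) :=
    integrable_inner_of_locallyIntegrableOn hfi cΨ hKc hKO zΨ
  have IB : Integrable (fun z : ℝ × EuclideanSpace ℝ (Fin 3) =>
      ⟪v z.1 z.2, timeDeriv Ψ z.1 z.2⟫ +
        1 * ⟪v z.1 z.2, convect (v z.1) (Ψ z.1) z.2⟫ +
        ⟪h z.1 z.2, convect (v z.1) (Ψ z.1) z.2⟫ + ⟪v z.1 z.2, convect (h z.1) (Ψ z.1) z.2⟫ +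
        ⟪v z.1 z.2, Δ (Ψ z.1) z.2⟫ + q z.1 z.2 * VectorCalculus.divergence (Ψ z.1) z.2 +
        ⟪f z.1 z.2, Ψ z.1 z.2⟫) := (((((B1.add B2).add B3).add B4).add B5).add B6).add B7
  -- ### subtract: the integrand of (A) − (B) is the drift integrand
  have hO' : MeasurableSet (O : Set (ℝ × EuclideanSpace ℝ (Fin 3))) := O.isOpen.measurableSet
  have hdiff := integral_sub IA.integrableOn IB.integrableOn
    (μ := volume.restrict (O : Set (ℝ × EuclideanSpace ℝ (Fin 3))))
  rw [hA, hB, sub_zero] at hdiff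
  rw [← hdiff]
  refine setIntegral_congr_fun hO' fun z _ => ?_
  have hW' : W z.1 z.2 = v z.1 z.2 + h z.1 z.2 := by rw [hv, hh, sub_add_cancel]
  simp only [convect, hW', map_add, inner_add_left, inner_add_right, one_mul]
  ring

end Kwon2023

end Literature.Analysis.FluidPDE

end
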